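import Summits.NavierStokesRegularity.NavierStokesRegularity.Theorems.ScenarioCensusRowF1ax
import Summits.NavierStokesRegularity.NavierStokesRegularity.Theorems.TypeICertificateLadderRungZero
import Literature.Analysis.FluidPDE.BarkerPrange2020VorticityAlignmentTypeIHolds
import Literature.Analysis.FluidPDE.TypeIAncientMildTimeAnalytic
import Literature.Analysis.FluidPDE.TypeIAncientMildRescale
import Summits.NavierStokesRegularity.NavierStokesRegularity.Theorems.LocalHelicityTubeDoorFrobeniusProfileRigidityHelicalSlice
import HarnessLib
import Summits.NavierStokesRegularity.NavierStokesRegularity.Theorems.ScenarioCensusRowF1NeedleTopRows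

/-!
# Census row F1, ECHO read-outs — mass-zero space–time increments of the velocity about fast points (cells F1ep / F1ew; floors EF / PEF) — LINE 39 «echo-top» port, part 1/3:
# §1 objects (frame of LINES 34–38 BY NAME; `EchoPocketAt`, `PointEchoAt`, the floors `EchoFloor` / `PointEchoFloor`, the rows `Row_F1ep` / `Row_F1ew`); §2 compactness and socket
# (LINE 37's, BY NAME); §3 Leray's every-time floor (BY NAME) and the WITNESS zoom package centred at GIVEN fast points (`exists_witnessZoom_package`)

Re-homed for the scenario census (typer seat ns-census-typer-1 g10; the cells F1ep / F1ew and the floors EF / PEF are MEMBERS OF RECORD «DECIDED IN KERNEL IN FILES» of row F1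
(item 82: critic idea-crit-3 g10 PASS 11:46:18Z; ref ns-census-ref g14 PRE-CHECK ✓ §19.6; lead label); this port makes them TREE-decided): VERBATIM PORT of ns-idea-3 LINE 39
«echo-top», `pub/ideators/ns-idea-3/lines/echo-top/line-echo-top.lean` sha16 2e8e6517bab89429 (1057 l., lean check rc 0, 0 sorry), split for the 400-line rule into
`ScenarioCensusRowF1EchoTop` (§1–§3) → `…EchoTopKill` (§4) → `…EchoTopRows` (§5–§7 + census KEYS).  Lean text VERBATIM in namespace `…Theorems.ScenarioCensus.EchoTop` (the
line's `…Cruxes.ScenarioCensusRowF1.EchoTopLine` re-homed); port edits: the frame restated VERBATIM by the line from LINES 34–38 (`topSet`, `HasTypeIConstant`, `snapLevel`,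
`exists_fast_at`, `sqrt_mul_sq_mul`, `pocket_limit`, `limitClass_compact`, `exists_level_of_limitKill`, `zoom_units`) is taken BY NAME from the landed two-time-top / one-level-top /
snapshot-top / needle-top ports; `@[conjecture]` on the residual `EchoCollapse` (≡ `ScenarioCensus.Row_F1`, OPEN); one-line docstrings added where missing (gate lint).  Statements
untouched.

No census VALUE is moved here (row F1 stays OPEN-WITH-LINE; the members become TREE-decided by name); NS regularity is NOT proved; `Row_F1` is untouched (zero
movement, `echoCollapse_iff_rowF1`); no summit statement is proved by this file. Lemmas that restate already-landed tree declarations are taken BY NAME (gate lint `dedup.landed`): `topSet` = `TwoTimeTop.topSet`, `HasTypeIConstant` = `OneLevelTop.HasTypeIConstant`, `snapLevel` = `SnapshotTop.snapLevel`, `exists_fast_at` = `SnapshotTop.exists_fast_at`, `sqrt_mul_sq_mul` = `SnapshotTop.sqrt_mul_sq_mul`, `pocket_limit` = `SnapshotTop.pocket_limit`, `limitClass_compact` = `NeedleTop.limitClass_compact`, `exists_level_of_limitKill` = `NeedleTop.exists_level_of_limitKill`, `zoom_units` = `NeedleTop.zoom_units`.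
-/

-- the summit and its single problem share the name `NavierStokesRegularity` (D-0017 nested layout)
set_option linter.dupNamespace false

noncomputable section

open MeasureTheory Set Function Filter TopologicalSpace Metric
open scoped Topology NNReal ENNReal InnerProductSpace

namespace Summit.NavierStokesRegularity.NavierStokesRegularity.Theorems.ScenarioCensus.EchoTop

open Literature.Analysis Literature.Analysis.FluidPDE
open Summit.NavierStokesRegularity.NavierStokesRegularity.Theorems
open Summit.NavierStokesRegularity.NavierStokesRegularity.Theses
open Summit.NavierStokesRegularity.NavierStokesRegularity.Theorems.LocalHelicityTubeDoorFrobeniusProfileRigidityHelicalSlice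

/-- `ℝ³`. -/
abbrev E3 := EuclideanSpace ℝ (Fin 3)

/-! ## §1 Objects: top, dimensionless Type-I constant, Leray's level `c_S`; the ECHO read-outs (a POCKET ECHO between ONE pair of instants, a POINT ECHO on a time window); floors, rows -/

-- `topSet`: the line restates the tree's `TwoTimeTop.topSet`; taken BY NAME (gate lint dedup.landed).

-- `HasTypeIConstant`: the line restates the tree's `OneLevelTop.HasTypeIConstant`; taken BY NAME (gate lint dedup.landed).

-- `snapLevel`: the line restates the tree's `SnapshotTop.snapLevel`; taken BY NAME (gate lint dedup.landed).

/-- **A POCKET ECHO at the instant `t` about the point `x`** (lag `θ ≥ 0`, dimensionless DRIFT `d ∈ ℝ³`, reach `A`, radius `a`,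
threshold `ε`; parabolic unit `ℓ = √(ν(T − t))`, speed unit `√ν/√(T − t)`): there is a pocket — a closed ball of radius `a ℓ` centred
within `A ℓ` of `x` — on which the velocity field at time `t` REPEATS, to dimensionless accuracy `ε`, the velocity field at the EARLIER
instant `t − θ(T − t)` displaced by `ℓ d`:  `√(T − t) ‖u(t, y) − u(t − θ(T − t), y + ℓ d)‖ ≤ ε √ν` for every `y` in the pocket.  NOTHING
is asked to be small or slow: the read-out is the INCREMENT between two space–time points (a mass-zero read-out in LINE 38's language),
and a fast pocket echoing itself at full speed is allowed.  `θ = 0, d ≠ 0`: the snapshot is `ℓd`-PERIODIC on the pocket to accuracy `ε`;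
`θ > 0, d = 0`: the pocket REPEATS ITS OWN PAST one lag ago (a parabolic ECHO); `θ > 0, d ≠ 0`: a TRAVELLING echo (the pattern one lag
ago, shifted by `ℓd` — locally a travelling wave of dimensionless velocity `−d/θ`).  `(θ, d) = (0, 0)` is the empty read-out and is
excluded in every statement. -/
def EchoPocketAt (ν T : ℝ) (u : ℝ → E3 → E3) (θ : ℝ) (d : E3) (A a ε t : ℝ) (x : E3) : Prop :=
  ∃ z : E3, ‖z - x‖ ≤ A * Real.sqrt (ν * (T - t)) ∧
    ∀ y : E3, ‖y - z‖ ≤ a * Real.sqrt (ν * (T - t)) →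
      Real.sqrt (T - t) * ‖u t y - u (t - θ * (T - t)) (y + (Real.sqrt (ν * (T - t))) • d)‖ ≤ ε * Real.sqrt ν

/-- **A POINT ECHO on a time window at `x`** (lag `θ > 0`, window `δ > 0`, threshold `ε`): during the whole window of instants
`τ ∈ [t − δ(T − t), t]` the velocity AT THE SINGLE POINT `x` repeats, to dimensionless accuracy `ε` (in the units of the instant `t`),
its own value one lag `θ(T − t)` earlier:  `√(T − t) ‖u(τ, x) − u(τ − θ(T − t), x)‖ ≤ ε √ν`.  The carrier is ONE POINT × a time window;
no spatial structure at all, and again no smallness of `u`. -/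
def PointEchoAt (ν T : ℝ) (u : ℝ → E3 → E3) (θ δ ε t : ℝ) (x : E3) : Prop :=
  ∀ τ ∈ Icc (t - δ * (T - t)) t, Real.sqrt (T - t) * ‖u τ x - u (τ - θ * (T - t)) x‖ ≤ ε * Real.sqrt ν

/-- **THE ECHO FLOOR** (structural theorem for EVERY Clay solution with a dimensionless Type-I constant `M`; PROVED, `echoFloor_holds`):
for every level `Λ > 0`, lag `θ ≥ 0`, drift `d` with `(θ, d) ≠ (0, 0)`, reach `A` and radius `a > 0` there is `ε = ε(M, Λ, θ, d, A, a) > 0`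
such that, for all instants `t < T` close enough to `T`, NO `Λ`-fast point has an `ε`-echo pocket with these parameters.  (No
maximality / blow-up hypothesis: for a solution bounded near `T` there are eventually no `Λ`-fast points at all.)  The quantifier over
fast points is UNIVERSAL — one echoing fast point at a sequence of instants `t_k ↑ T` is already impossible. -/
def EchoFloor : Prop :=
  ∀ (M Λ θ A a : ℝ) (d : E3), 0 < Λ → 0 ≤ θ → (0 < θ ∨ d ≠ 0) → 0 < a → ∃ ε : ℝ, 0 < ε ∧
    ∀ (ν T : ℝ), 0 < ν → 0 < T → ∀ (u : ℝ → E3 → E3) (p : ℝ → E3 → ℝ),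
    IsClassicalNSSolutionOn (Ico 0 T) ν 0 u p → IsLerayHopfOn T ν 0 (u 0) u →
    HasRapidSpatialDecay (u 0) → OneLevelTop.HasTypeIConstant ν T M u →
    ∀ᶠ t in 𝓝[<] T, ∀ x ∈ TwoTimeTop.topSet ν T u Λ t, ¬ EchoPocketAt ν T u θ d A a ε t x

/-- **THE POINT-ECHO FLOOR** (PROVED, `pointEchoFloor_holds`): for every level `Λ > 0`, lag `θ > 0` and window `δ > 0` there is
`ε = ε(M, Λ, θ, δ) > 0` such that eventually NO `Λ`-fast point echoes itself (lag `θ(T − t)`, accuracy `ε`) throughout the window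
`[t − δ(T − t), t]`. -/
def PointEchoFloor : Prop :=
  ∀ (M Λ θ δ : ℝ), 0 < Λ → 0 < θ → 0 < δ → ∃ ε : ℝ, 0 < ε ∧
    ∀ (ν T : ℝ), 0 < ν → 0 < T → ∀ (u : ℝ → E3 → E3) (p : ℝ → E3 → ℝ),
    IsClassicalNSSolutionOn (Ico 0 T) ν 0 u p → IsLerayHopfOn T ν 0 (u 0) u →
    HasRapidSpatialDecay (u 0) → OneLevelTop.HasTypeIConstant ν T M u →
    ∀ᶠ t in 𝓝[<] T, ∀ x ∈ TwoTimeTop.topSet ν T u Λ t, ¬ PointEchoAt ν T u θ δ ε t x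

/-- **ROW F1ep «ECHO POCKETS»** (Type I · no symmetry · Clay class; census shape; PROVED, `rowF1ep_holds`, a corollary of the floor at
Leray's level `c_S`): for every `M`, lag `θ ≥ 0`, drift `d`, `(θ, d) ≠ (0, 0)`, reach `A`, radius `a > 0` there is `ε > 0` such that: if
along SOME sequence of instants `t_k ↑ T` every `c_S`-fast point has an `ε`-echo pocket, the solution extends smoothly past `T`. -/
def Row_F1ep : Prop :=
  ∀ (M θ A a : ℝ) (d : E3), 0 ≤ θ → (0 < θ ∨ d ≠ 0) → 0 < a → ∃ ε : ℝ, 0 < ε ∧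
    ∀ (ν T : ℝ), 0 < ν → 0 < T → ∀ (u : ℝ → E3 → E3) (p : ℝ → E3 → ℝ),
    IsClassicalNSSolutionOn (Ico 0 T) ν 0 u p → IsLerayHopfOn T ν 0 (u 0) u →
    HasRapidSpatialDecay (u 0) → OneLevelTop.HasTypeIConstant ν T M u →
    (∃ᶠ t in 𝓝[<] T, ∀ x ∈ TwoTimeTop.topSet ν T u SnapshotTop.snapLevel t, EchoPocketAt ν T u θ d A a ε t x) →
    HasSmoothExtensionPast ν 0 u T

/-- **ROW F1ew «POINT ECHOES ON A WINDOW»** (Type I · no symmetry · Clay class; PROVED, `rowF1ew_holds`): for every `M`, lag `θ > 0`,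
window `δ > 0` there is `ε > 0` such that: if along some `t_k ↑ T` every `c_S`-fast point `ε`-echoes itself with lag `θ(T − t_k)`
throughout `[t_k − δ(T − t_k), t_k]`, the solution extends smoothly past `T`. -/
def Row_F1ew : Prop :=
  ∀ (M θ δ : ℝ), 0 < θ → 0 < δ → ∃ ε : ℝ, 0 < ε ∧
    ∀ (ν T : ℝ), 0 < ν → 0 < T → ∀ (u : ℝ → E3 → E3) (p : ℝ → E3 → ℝ),
    IsClassicalNSSolutionOn (Ico 0 T) ν 0 u p → IsLerayHopfOn T ν 0 (u 0) u →
    HasRapidSpatialDecay (u 0) → OneLevelTop.HasTypeIConstant ν T M u →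
    (∃ᶠ t in 𝓝[<] T, ∀ x ∈ TwoTimeTop.topSet ν T u SnapshotTop.snapLevel t, PointEchoAt ν T u θ δ ε t x) →
    HasSmoothExtensionPast ν 0 u T

/-! ## §2 COMPACTNESS of `𝒦_M` (values pointwise AND locally uniformly on slices, gradients pointwise) and the SOCKET LEMMA

`𝒦_M` = `IsTypeIAncientMild M`.  The tree's extraction theorem `exists_tendsto_of_typeI_seq_Ioo` (KNSS 2009, Lemma 6.1) fed with
MEMBERS of `𝒦_M` is the sequential compactness of `𝒦_M` (values pointwise and locally uniformly on slices, gradients pointwise;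
LINES 36–38 VERBATIM).  An ECHO is read at FIXED pairs of space–time points of the zoom (only the pocket centre moves, handled by
LINE 36's `SnapshotTop.pocket_limit`), so this line uses only the pointwise clause; the other two are kept so that the socket lemma is literally
the one of LINES 35–38. -/

-- `limitClass_compact`: the line restates the tree's `NeedleTop.limitClass_compact`; taken BY NAME (gate lint dedup.landed).

-- `tendstoLocallyUniformly_comp_of_tendsto`: a statement-twin of the landed `AdaptedFrequencyTangentFlowTransfer.tendstoLocallyUniformly_comp_of_tendsto` (whose module imports a route file and is therefore NOT imported here; gate lint dedup.landed); not re-declared — unused below.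

-- `exists_level_of_limitKill`: the line restates the tree's `NeedleTop.exists_level_of_limitKill`; taken BY NAME (gate lint dedup.landed).

/-! ## §3 MECHANISM, part 1 — Leray's EVERY-TIME floor (for the census rows) and the WITNESS ZOOM PACKAGE (new: centred at GIVEN fast points)

LINES 36–38 centred their zooms at `c_S`-fast points supplied by Leray's every-time lower rate under NON-extension (`SnapshotTop.exists_fast_at`,
kept here for the census-shaped rows).  THE WITNESS PACKAGE below instead takes the centres FROM THE HYPOTHESIS: if frequently as
`t ↑ T` there is a `Λ`-fast point `x` with a property `Q t x`, the zooms centred at such `(t_j, x_j)` converge in `𝒦_M` (SAME `M`) to a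
limit with `‖W(−1, 0)‖ ≥ Λ` — for ANY level `Λ`, with NO maximality hypothesis (the Type-I window alone runs the tree's zoom lemmas
`zoom_continuousOn` / `zoom_isWeaklyDivFree` / `zoom_oseen` / `zoom_norm_le` and the extraction `exists_tendsto_of_typeI_seq_Ioo`).
This is what makes the floors of this line UNIVERSAL over fast points (every `Λ`-fast point fails to echo), where LINES 36–38 could
only say that SOME `c_S`-fast point fails to be calm. -/

-- `exists_fast_at`: the line restates the tree's `SnapshotTop.exists_fast_at`; taken BY NAME (gate lint dedup.landed).

-- `sqrt_mul_sq_mul`: the line restates the tree's `SnapshotTop.sqrt_mul_sq_mul`; taken BY NAME (gate lint dedup.landed).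

/-- **THE WITNESS ZOOM PACKAGE (centres given by the hypothesis; any level; no maximality).**  Let `u` be a classical Clay solution
on `[0, T)` with dimensionless Type-I constant `M`, and let `Q t x` be any property such that FREQUENTLY as `t ↑ T` some `Λ`-fast point
`x` has `Q t x`.  Then there are scales `c_j ↓ 0`, centres `x_j` and a member `W ∈ 𝒦_M` (SAME `M`) such that: at the centre times
`t_j = T − c_j²ν` the centre `x_j` is `Λ`-fast and `Q t_j x_j`; the zooms `c_j u(T + c_j²ν s, x_j + c_jν y)` converge to `W(s, y)` at
every point of the open past (with their spatial gradients, and locally uniformly in `y` on every slice); and `‖W(−1, 0)‖ ≥ Λ`. -/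
theorem exists_witnessZoom_package {ν T M : ℝ} (hν : 0 < ν) (hT : 0 < T)
    {u : ℝ → E3 → E3} {p : ℝ → E3 → ℝ}
    (hsol : IsClassicalNSSolutionOn (Ico 0 T) ν 0 u p) (hLH : IsLerayHopfOn T ν 0 (u 0) u)
    (hdec : HasRapidSpatialDecay (u 0)) (hM : OneLevelTop.HasTypeIConstant ν T M u)
    {Λ : ℝ} {Q : ℝ → E3 → Prop} (hQ : ∃ᶠ t in 𝓝[<] T, ∃ x ∈ TwoTimeTop.topSet ν T u Λ t, Q t x) :
    ∃ (c : ℕ → ℝ) (x : ℕ → E3) (W : ℝ → E3 → E3),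
      (∀ j, 0 < c j) ∧ Tendsto c atTop (𝓝 0) ∧ IsTypeIAncientMild M W ∧
      (∀ j, Q (T + c j ^ 2 * ν * (-1)) (x j)) ∧
      (∀ j, x j ∈ TwoTimeTop.topSet ν T u Λ (T + c j ^ 2 * ν * (-1))) ∧
      (∀ s < 0, ∀ y : E3,
        Tendsto (fun j => (c j * 1) • u (T + c j ^ 2 * ν * s) (x j + (c j * ν) • y)) atTop (𝓝 (W s y))) ∧
      (∀ s < 0, ∀ y : E3,
        Tendsto (fun j => fderiv ℝ (fun y' : E3 => (c j * 1) • u (T + c j ^ 2 * ν * s) (x j + (c j * ν) • y')) y)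
          atTop (𝓝 (fderiv ℝ (W s) y))) ∧
      (∀ s < 0, TendstoLocallyUniformly
        (fun j => fun y : E3 => (c j * 1) • u (T + c j ^ 2 * ν * s) (x j + (c j * ν) • y)) (W s) atTop) ∧
      Λ ≤ ‖W (-1) 0‖ := by
  -- ## (1) the rate window and the WITNESS sequence `(t_k, x_k)`: `Q t_k x_k`, `T − t_k < δ/(k+2)`, `x_k` `Λ`-fast at `t_k`
  obtain ⟨δ, hδ, hδT, hrate⟩ := OneLevelTop.exists_window_of_hasTypeIConstant hT hM
  have hseq : ∀ k : ℕ, ∃ t : ℝ, ∃ x : E3, t ∈ Ioo (T - δ / ((k : ℝ) + 2)) T ∧ Q t x ∧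
      Λ * Real.sqrt ν ≤ Real.sqrt (T - t) * ‖u t x‖ := by
    intro k
    have hpos : 0 < δ / ((k : ℝ) + 2) := by positivity
    have hIoo : ∀ᶠ t in 𝓝[<] T, t ∈ Ioo (T - δ / ((k : ℝ) + 2)) T := Ioo_mem_nhdsLT (by linarith)
    obtain ⟨t, ⟨x, hxtop, hQtx⟩, htI⟩ := (hQ.and_eventually hIoo).exists
    exact ⟨t, x, htI, hQtx, hxtop⟩
  choose t x htI hQt hfast using hseq
  have hTt : ∀ k, 0 < T - t k := fun k => sub_pos.2 (htI k).2
  have hTtδ : ∀ k, T - t k < δ / ((k : ℝ) + 2) := fun k => by linarith [(htI k).1]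
  -- ## (2) scales `c_k = √((T − t_k)/ν)`: `c_k² ν = T − t_k`, `c_k → 0`
  set c : ℕ → ℝ := fun k => Real.sqrt ((T - t k) / ν) with hc
  have hcpos : ∀ k, 0 < c k := fun k => Real.sqrt_pos.2 (div_pos (hTt k) hν)
  have hc2 : ∀ k, c k ^ 2 * ν = T - t k := by
    intro k
    simp only [hc]
    rw [Real.sq_sqrt (div_pos (hTt k) hν).le]
    field_simp
  have het : ∀ k, T + c k ^ 2 * ν * (-1) = t k := fun k => by rw [hc2 k]; ring
  have hclim : Tendsto c atTop (𝓝 0) := by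
    have hk2 : Tendsto (fun k : ℕ => (k : ℝ) + 2) atTop atTop :=
      tendsto_atTop_add_const_right _ _ tendsto_natCast_atTop_atTop
    have hup0 : Tendsto (fun k : ℕ => δ / ((k : ℝ) + 2)) atTop (𝓝 0) := tendsto_const_nhds.div_atTop hk2
    have hupper : Tendsto (fun k : ℕ => δ / ((k : ℝ) + 2) / ν) atTop (𝓝 0) := by
      simpa using hup0.div_const ν
    have h1 : Tendsto (fun k => (T - t k) / ν) atTop (𝓝 0) :=
      tendsto_of_tendsto_of_tendsto_of_le_of_le tendsto_const_nhds hupper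
        (fun k => (div_pos (hTt k) hν).le) (fun k => div_le_div_of_nonneg_right (hTtδ k).le hν.le)
    have h2 := h1.sqrt
    rw [Real.sqrt_zero] at h2
    exact h2
  -- ## (3) the zooms and their windows `(A_k, 0)`, `A_k → −∞`
  have hα : (1 : ℝ) = ν / ν := (div_self hν.ne').symm
  have hβ : ν = ν ^ 2 / ν := by rw [sq, mul_div_cancel_right₀ _ hν.ne']
  set w : ℕ → ℝ → E3 → E3 := fun k => (c k * 1) • stPull (c k ^ 2 * ν) (c k * ν) T (x k) u with hw
  set Aw : ℕ → ℝ := fun k => -(δ / (c k ^ 2 * ν)) with hA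
  have hAwle : ∀ k, Aw k ≤ -((k : ℝ) + 2) := by
    intro k
    have hk : 0 < (k : ℝ) + 2 := by positivity
    have hprod : (T - t k) * ((k : ℝ) + 2) < δ := (lt_div_iff₀ hk).1 (hTtδ k)
    simp only [hA]
    rw [hc2 k, neg_le_neg_iff, le_div_iff₀ (hTt k)]
    linarith [mul_comm (T - t k) ((k : ℝ) + 2)]
  have hAlim : Tendsto Aw atTop atBot := by
    have h1 : Tendsto (fun k : ℕ => -((k : ℝ) + 2)) atTop atBot :=
      tendsto_neg_atTop_atBot.comp (tendsto_atTop_add_const_right _ _ tendsto_natCast_atTop_atTop)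
    exact tendsto_atBot_mono hAwle h1
  have hcW : ∀ k, ContinuousOn (uncurry (w k)) (Ioo (Aw k) 0 ×ˢ univ) := fun k =>
    zoom_continuousOn hν hsol hν hα hβ (hcpos k) hδT
  have hdivW : ∀ k, ∀ s ∈ Ioo (Aw k) 0, IsWeaklyDivFree (w k s) := fun k s hs =>
    zoom_isWeaklyDivFree hν hsol hν hα hβ (hcpos k) hδT hs
  have hmildW : ∀ k, ∀ s s' : ℝ, Aw k < s → s < s' → s' < 0 → ∀ y,
      w k s' y = UnboundedOperators.heatExtension (w k s) (s' - s) y -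
        oseenDuhamel 1 s (w k) (w k) s' y := fun k s s' hs hss' hs' y =>
    zoom_oseen hν hT hsol hLH hdec hν hα hβ (hcpos k) hδT hs hss' hs' y
  have hIW : ∀ k, ∀ s ∈ Ioo (Aw k) 0, ∀ y, ‖w k s y‖ ≤ M / Real.sqrt (-s) := by
    intro k s hs y
    have h : ‖w k s y‖ ≤ (1 * (M * Real.sqrt ν) / Real.sqrt ν) / Real.sqrt (-s) :=
      zoom_norm_le (x₀ := x k) hν hα hβ hν (hcpos k) hδT hrate hs y
    have e : (1 : ℝ) * (M * Real.sqrt ν) / Real.sqrt ν = M := by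
      rw [one_mul, mul_div_cancel_right₀ _ (Real.sqrt_pos.2 hν).ne']
    rw [e] at h
    exact h
  -- ## (4) extraction of a limit `W ∈ 𝒦_M` (SAME constant `M`), values and gradients pointwise, values locally uniformly
  obtain ⟨φ, hφ, W, hW, hpt, hgrad, hlu, -⟩ := exists_tendsto_of_typeI_seq_Ioo M hAlim hcW hdivW hmildW hIW
  have hφt : Tendsto φ atTop atTop := hφ.tendsto_atTop
  -- ## (5) normalisation at `(−1, 0)`
  have hnorm : ∀ k, Λ ≤ ‖w k (-1) 0‖ := by
    intro k
    have e1 : w k (-1) 0 = (c k * 1) • u (T + c k ^ 2 * ν * (-1)) (x k + (c k * ν) • (0 : E3)) := by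
      simp only [hw, smul_stPull_apply]
    rw [e1, smul_zero, add_zero, het, mul_one, norm_smul, Real.norm_eq_abs, abs_of_pos (hcpos k)]
    have hsq : Real.sqrt (T - t k) = c k * Real.sqrt ν := by
      rw [← hc2 k, Real.sqrt_mul (sq_nonneg _), Real.sqrt_sq (hcpos k).le]
    have h2 : Λ * Real.sqrt ν ≤ c k * ‖u (t k) (x k)‖ * Real.sqrt ν := by
      have h := hfast k
      rw [hsq] at h
      linarith [h, (by ring : c k * Real.sqrt ν * ‖u (t k) (x k)‖ = c k * ‖u (t k) (x k)‖ * Real.sqrt ν)]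
    exact le_of_mul_le_mul_right h2 (Real.sqrt_pos.2 hν)
  have hge : Λ ≤ ‖W (-1) 0‖ :=
    ge_of_tendsto ((hpt (-1) (by norm_num) 0).norm) (Eventually.of_forall fun j => hnorm (φ j))
  -- ## (6) package along the subsequence
  have hwu : ∀ (k : ℕ) (s : ℝ),
      w k s = fun y => (c k * 1) • u (T + c k ^ 2 * ν * s) (x k + (c k * ν) • y) :=
    fun k s => funext fun y => by simp only [hw, smul_stPull_apply]
  have hfastTop : ∀ k, x k ∈ TwoTimeTop.topSet ν T u Λ (T + c k ^ 2 * ν * (-1)) := by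
    intro k
    rw [TwoTimeTop.mem_topSet, het]
    exact hfast k
  refine ⟨fun j => c (φ j), fun j => x (φ j), W, fun j => hcpos _, hclim.comp hφt, hW,
    fun j => by rw [het]; exact hQt (φ j), fun j => hfastTop (φ j), fun s hs y => ?_, fun s hs y => ?_,
    fun s hs => ?_, hge⟩
  · exact (hpt s hs y).congr fun j => by rw [hwu]
  · exact (hgrad s hs y).congr fun j => by rw [hwu]
  · intro U hU y
    obtain ⟨V, hV, hev⟩ := hlu s hs U hU y
    refine ⟨V, hV, ?_⟩
    filter_upwards [hev] with j hj z hz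
    simpa only [hwu] using hj z hz

end Summit.NavierStokesRegularity.NavierStokesRegularity.Theorems.ScenarioCensus.EchoTop

end
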